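import Summits.CriticalPhenomena.SAWScalingLimit.Theses.SAWSpinMonotone

/-!
# Sketch — first lemmas of the far–near factorisation (strategist, crux stmt-CriticalPhenomena-16771)

The technique behind stub SB (`SpreadBudget`) of `Lines/farnear.lean`: split every first arrival `γ` at an
index `i` (its last entrance into a ball around `v`); the winding is additive across the split when the two
halves share the segment through the split point, so the parafermionic weight FACTORISES into a far factor and a
near factor; summing over `γ` with fixed boundary datum gives the first-arrival law as an exact mixture of
convolutions, the loop dressing riding on the near factor.  All three lemmas below are PROVED (sorry-free); the combinatorial half of
the factorisation (the bijection γ ↔ (far part, near part) at the last entrance, with its compatibility condition) and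
the resulting mixture-of-convolutions identity are prover-side helpers (`--supports stmt-CriticalPhenomena-16771`).
-/

noncomputable section

open Literature.Probability.LatticeModels
open Literature.Probability.RandomPlanarGeometry

namespace Summit.CriticalPhenomena.SAWScalingLimit.Cruxes.DressingTransfer.Farnear.Sketch

/-- FIRST LEMMA (PROVED here, induction on `xs`): additivity of the polyline winding across a split that keeps
the shared segment `p → q` on both sides (so no turning angle is lost or double counted). -/
theorem winding_append_overlap (xs ys : List ℂ) (p q : ℂ) :
    winding (xs ++ p :: q :: ys) = winding (xs ++ [p, q]) + winding (p :: q :: ys) := by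
  induction xs with
  | nil => simp
  | cons x xs ih =>
    cases xs with
    | nil =>
      simp only [List.cons_append, List.nil_append, winding_cons_cons_cons, winding_pair, add_zero]
    | cons y zs =>
      cases zs with
      | nil =>
        simp only [List.cons_append, List.nil_append] at ih ⊢
        rw [winding_cons_cons_cons, winding_cons_cons_cons x y p [q], ih]
        ring
      | cons z ws =>
        simp only [List.cons_append] at ih ⊢
        rw [winding_cons_cons_cons, winding_cons_cons_cons x y z (ws ++ [p, q]), ih]
        ring

/-- The far part of a first arrival up to the split index `i`: the polyline `mid(a), c(v₁), …, c(v_{i+1})`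
(the first `i + 2` points). -/
def farPoints {Λ : Finset HexVertex} {a z : Sym2 HexVertex} (γ : SAW.HexMidEdgeSAW Λ a z) (i : ℕ) : List ℂ :=
  γ.points.take (i + 2)

/-- The near part from the split index: the polyline `c(vᵢ), c(v_{i+1}), …, mid(z)` (sharing the segment
`c(vᵢ) → c(v_{i+1})` with the far part). -/
def nearPoints {Λ : Finset HexVertex} {a z : Sym2 HexVertex} (γ : SAW.HexMidEdgeSAW Λ a z) (i : ℕ) : List ℂ :=
  γ.points.drop i

/-- SECOND LEMMA (PROVED here from the first): the winding of a walk is the far winding plus the near winding,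
for every split index inside the walk. -/
theorem winding_eq_far_add_near {Λ : Finset HexVertex} {a z : Sym2 HexVertex} (γ : SAW.HexMidEdgeSAW Λ a z)
    (i : ℕ) (hi : i + 2 ≤ γ.points.length) :
    γ.winding = winding (farPoints γ i) + winding (nearPoints γ i) := by
  unfold SAW.HexMidEdgeSAW.winding farPoints nearPoints
  set L := γ.points with hL
  have hi1 : i < L.length := by omega
  have hi2 : i + 1 < L.length := by omega
  have hdrop : L.drop i = L[i] :: L[i + 1] :: L.drop (i + 2) := by
    rw [List.drop_eq_getElem_cons hi1, List.drop_eq_getElem_cons hi2]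
  have h2 : (L.drop i).take 2 = [L[i], L[i + 1]] := by
    rw [hdrop]; rfl
  have htake : L.take (i + 2) = L.take i ++ [L[i], L[i + 1]] := by
    rw [List.take_add, h2]
  have hsplit : L = L.take i ++ L[i] :: L[i + 1] :: L.drop (i + 2) := by
    rw [← hdrop, List.take_append_drop]
  conv_lhs => rw [hsplit]
  rw [winding_append_overlap, ← htake, ← hdrop]

/-- THIRD LEMMA (PROVED here; the factorisation of the parafermionic weight): `e^{-isW(γ)} x^{ℓ(γ)} =
(e^{-isW⁻} x^{i}) · (e^{-isW⁺} x^{ℓ-i})` for every split index — the algebraic heart of the far–near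
factorisation; summing over the walks with a fixed boundary datum at the split turns the first-arrival
transform into `Σ_β ĝ^β(s) · ℓ̂^β(s)` and the dressed transform into `Σ_β ĝ^β(s) · d̂^β(s)` with the SAME far
factors `ĝ^β`. -/
theorem weight_eq_far_mul_near {Λ : Finset HexVertex} {a z : Sym2 HexVertex} (γ : SAW.HexMidEdgeSAW Λ a z)
    (i : ℕ) (hi : i + 2 ≤ γ.points.length) (hiℓ : i ≤ γ.length) (x s : ℝ) :
    γ.weight x s =
      (Complex.exp (-Complex.I * s * (winding (farPoints γ i) : ℝ)) * (x : ℂ) ^ i) *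
        (Complex.exp (-Complex.I * s * (winding (nearPoints γ i) : ℝ)) * (x : ℂ) ^ (γ.length - i)) := by
  unfold SAW.HexMidEdgeSAW.weight
  rw [winding_eq_far_add_near γ i hi, Complex.ofReal_add,
    show (x : ℂ) ^ γ.length = (x : ℂ) ^ i * (x : ℂ) ^ (γ.length - i) by
      rw [← pow_add, Nat.add_sub_cancel' hiℓ],
    mul_add, Complex.exp_add]
  ring

end Summit.CriticalPhenomena.SAWScalingLimit.Cruxes.DressingTransfer.Farnear.Sketch

end
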